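import Summits.AtomisticToContinuum.Statement
import Summits.AtomisticToContinuum.BoseEinsteinCondensation.Theorems.BECInfraredBoundAssembly

/-!
# AtomisticToContinuum — route `BECRenormGroup`, rank-1 assembly

Settles `stmt-AtomisticToContinuum-0687` for route `BECRenormGroup` (positive): the typable
consequence `X_B1` (zero-mode macroscopic occupation of Dirichlet near-minimisers,
`stmt-AtomisticToContinuum-0686`) of the informal RG thesis `X_B2` implies
`Literature.MathematicalPhysics.QuantumManyBody.BoseGas.BoseEinsteinCondensation`. This is literally the assembly of route
`BECInfraredBound` (`AtomisticToContinuum.BECInfraredBound.bec_of_zeroMode`); recorded under this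
route's namespace so the route has its assembly edge in the tree. The RG cruxes
(`stmt-…-0692`–`0695`) are informal (no second-quantised Bose gas layer) and untouched.
-/

namespace AtomisticToContinuum.BECRenormGroup

/-- Settles stmt-AtomisticToContinuum-0687 (route BECRenormGroup assembly): `X_B1 →
BoseEinsteinCondensation`, by `BECInfraredBound.bec_of_zeroMode`
(occupation of the normalised constant mode ≤ maxOccupation ≤ condensateNumber). [folklore] -/
theorem bec_of_zeroMode_rg :
    (∀ v : ℝ → ENNReal, Literature.MathematicalPhysics.QuantumManyBody.BoseGas.IsRepulsiveFiniteRange v → ∃ ρ₀ : ℝ, 0 < ρ₀ ∧ ∀ ρ : ℝ, 0 < ρ → ρ < ρ₀ → ∃ c : ℝ, 0 < c ∧ ∀ᶠ N : ℕ in Filter.atTop, ∃ δ : ENNReal, 0 < δ ∧ ∀ Ψ : Literature.MathematicalPhysics.QuantumManyBody.BoseGas.TrialState N (Literature.MathematicalPhysics.QuantumManyBody.BoseGas.sideLength ρ N), Literature.MathematicalPhysics.QuantumManyBody.BoseGas.energy v Ψ ≤ Literature.MathematicalPhysics.QuantumManyBody.BoseGas.groundStateEnergy v N (Literature.MathematicalPhysics.QuantumManyBody.BoseGas.sideLength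 ρ N) + δ → ENNReal.ofReal (c * N) ≤ Literature.MathematicalPhysics.QuantumManyBody.BoseGas.occupation N ((Literature.MathematicalPhysics.QuantumManyBody.BoseGas.box (Literature.MathematicalPhysics.QuantumManyBody.BoseGas.sideLength ρ N)).indicator fun _ => ((Real.sqrt (Literature.MathematicalPhysics.QuantumManyBody.BoseGas.sideLength ρ N ^ 3))⁻¹ : ℂ)) Ψ.ψ) → Literature.MathematicalPhysics.QuantumManyBody.BoseGas.BoseEinsteinCondensation :=
  AtomisticToContinuum.BECInfraredBound.bec_of_zeroMode

end AtomisticToContinuum.BECRenormGroup
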